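import Summits.HodgeConjecture.HodgeConjecture.Theorems.SixfoldTableXCensusWeilCMGeneralRowsEndField
import Literature.AlgebraicGeometry.HodgeTheory.WeilTypeCMFieldOneBalancedPlaceHodgeLie
import Literature.AlgebraicGeometry.HodgeTheory.WeilTypeCMFieldHodgeGroupUEOfLie
import Literature.AlgebraicGeometry.Deligne1982.SplitWeilTypeCMPeriodTransport
import Literature.AlgebraicGeometry.Milne1999.CentraliserFixesDivisorClasses
import HarnessLib

/-!
# TABLE X (dimension 6) — ROW 13 `g6.IV(3,1).kE0` (simple sixfolds of Weil type `(3, d)` with `End⁰(A) = E ⊋ K` a SEXTIC CM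
# field, CM pattern `(2,2,1)`), EVERY MEMBER: the census nodes X2 ∕ X1 (+ domain, isogeny class) and «HC ⟸ {Markman₆, R-W6}»
# with NO displayed Hodge-group and NO displayed Lie hypothesis (cell `pub-hodgeav-hg6`, req-37 (A) Q2b; eng-3 g3, job B6 row 13,
# stage (5); lead g3 2026-08-29T05:24:43Z)

HONEST FRAMING. HC, `HC_AV` (stmt-1333), `HC_CM` (stmt-3052) and H2 are NOT proved and do not occur. X2 ∕ X1 stay
`@[conjecture]` (OURS) — what is proved is the census verdict «X2-at-`A` ∧ X1-at-`A`» for the members named; R-W6 and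
Markman₆ (preprint, unrefereed) appear only as displayed hypotheses of the HC corollary. KERNEL ONLY: theorems over existing
declarations; no definition, no `sorry`, no named fact; restates nothing.

WHAT THIS FILE DOES. L16 ∕ L16b (`SixfoldTableXCensusWeilCMGeneralRows(EndField)`) give the census at rows 11 ∕ 13 for the
GENERAL member, displaying the group hypothesis `hG` («every `u ∈ S(A)(h)(ℂ)` with `det(u | W_K) = 1` lies in `Hg(A)(ℂ)|_{H¹}`»).
For ROW 13 this hypothesis is now a THEOREM for EVERY member (§0 `hG_of_kWeil_cmField`), by the chain
(i) ROW-13 LIE THEOREM `IsWeilType.mem_hodgeLieC_of_commute_of_skew_of_trace_of_cmField` (p700913: `Lie Hg(H¹A)_ℂ ⊇ (𝔲_E ∩ 𝔰𝔲_K)_ℂ`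
for one balanced place + the `K`-datum; bricks `CMThetaCentre.centre_of_pair_kWeil` p699381, `CMThetaOneBalancedKWeil.*` p699639,
and eng-5 g6's LIFT `CMNoTwist.lift_of_unique_balanced` ∕ `CMIrred.eigenspace_irreducible`) ⟹ (ii) the `E ⊋ K` SOCKET
`IsWeilType.mem_hodgeGroupOne_of_mem_unitaryCentralizerGroup_of_cmField_of_hodgeLieC` (p698115, B5a-E) ⟹ `hG`, with
`h ∈ hodgeClassSpan` from the Kähler multiple (`isOfHodgeType_one_one_of_isKaehlerClass_smul`) and `Q_h` non-degenerate by hard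
Lefschetz (`eq_zero_of_forall_polarizationPairingOne_eq_zero_of_hasHardLefschetzProperty`). §1–§3 are L16b's three theorems with
`hG` DELETED and the member data of (i) added. Row 11 (`IV(2,1).kE0`, E biquadratic) keeps its displayed `hG` (eng-4 g8's square).
All declarations in the sub-namespace `TableX.WeilLieRows`; typed ≠ proved.
-/

set_option linter.dupNamespace false

noncomputable section

open scoped TensorProduct
open CategoryTheory
open Literature.AlgebraicGeometry Literature.AlgebraicGeometry.Motives
open Literature.AlgebraicGeometry.Motives.AbelianVariety (IsIsogenous IsSimple)
open Literature.AlgebraicGeometry.Motives.HodgeStructure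
open Literature.AlgebraicGeometry.HodgeTheory
open Literature.AlgebraicGeometry.Milne1999
open Literature.AlgebraicGeometry.Deligne1982 (isOfHodgeType_one_one_of_isKaehlerClass_smul)
open Literature.AlgebraicGeometry.VanGeemen1994 (pullbackOne hodgeGroupOne detOnEigenspace hodgeClassSpan)
open Literature.AlgebraicTopology.SingularHomology
open Literature.Barriers.HodgeConjecture
open Literature.Geometry.Kaehler (HasHardLefschetzProperty)
open Summit.HodgeConjecture.HodgeConjecture.Ring2.ClassTargets
open Summit.HodgeConjecture.HodgeConjecture.Ring2.Motiv (ProdCMCell)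
open Summit.HodgeConjecture.HodgeConjecture.Ring2.Atlas (IsQuarticFieldTypeIVFourfold)

namespace Summit.HodgeConjecture.HodgeConjecture.TableX.WeilLieRows

/-! ## §0 The group hypothesis `hG` of L16 ∕ L16b is a theorem for every ROW-13 member -/

section Socket

variable {A : AbelianVariety ℂ} {φ : A ⟶ A} {d : ℕ} {h : complexBetti A.X 2}

/-- **`hG` FOR EVERY ROW-13 MEMBER**: for a simple `(A, φ)` of Weil type `(3, d)` with the row-13 member data (module
docstring) and a rational class `h` with a Kähler multiple for which `φ^*` is a `d`-similitude of `Q_h`, every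
`u ∈ S(A)(h)(ℂ)` with `det(u | W_K) = 1` lies in `Hg(A)(ℂ)|_{H¹}` — row-13 Lie theorem ∘ `E ⊋ K` socket. HC NOT proved.
[cite: MoonenZarhin1998WeilClasses, §4 Remark (1)] [cite: MoonenZarhin1999LowDim, §2 (2.3)]
[cite: Deligne1982HodgeCycles, I §3 Prop. 3.4 and 3.6] [cite: VoisinHodgeI2002, Thm. 6.25] -/
theorem hG_of_kWeil_cmField {ι : Type} [Fintype ι] [DecidableEq ι] (hι : Fintype.card ι ≤ 3)
    (hW : IsWeilType A φ 3 d) (hS : IsSimple A) (φE : A ⟶ A) (hE : Module.finrank ℚ A.endAlgebra = 2 * Fintype.card ι)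
    (μ : ι → ℂ) (hinj : Function.Injective μ) (hdist : ∀ k k', μ k' ≠ starRingEnd ℂ (μ k))
    (hmult : ∀ k, eigenMultiplicity A φE (μ k) + eigenMultiplicity A φE (starRingEnd ℂ (μ k)) = 2)
    (k₀ : ι) (hk₀ : eigenMultiplicity A φE (μ k₀) ≠ 0 ∧ eigenMultiplicity A φE (starRingEnd ℂ (μ k₀)) ≠ 0)
    (hunb : ∀ k, k ≠ k₀ → eigenMultiplicity A φE (μ k) = 0 ∨ eigenMultiplicity A φE (starRingEnd ℂ (μ k)) = 0)
    (k₁ k₂ : ι) (hk₁₂ : k₁ ≠ k₂) (hk₁ : k₁ ≠ k₀) (hk₂ : k₂ ≠ k₀)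
    (hKW : eigenMultiplicity A φE (μ k₁) + eigenMultiplicity A φE (μ k₂) = 2)
    (hKE : ∀ k, Module.End.eigenspace (((bettiCohomology.map φE.hom.hom.hom 1).hom).baseChange ℂ) (μ k) ≤
      Module.End.eigenspace (((bettiCohomology.map φ.hom.hom.hom 1).hom).baseChange ℂ) (Complex.I * (Real.sqrt d : ℂ)))
    (hKE' : ∀ k, Module.End.eigenspace (((bettiCohomology.map φE.hom.hom.hom 1).hom).baseChange ℂ) (starRingEnd ℂ (μ k)) ≤
      Module.End.eigenspace (((bettiCohomology.map φ.hom.hom.hom 1).hom).baseChange ℂ) (-(Complex.I * (Real.sqrt d : ℂ))))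
    (hQ : IsRationalClass h) (hK : ∃ s : ℝ, 0 < s ∧ IsKaehlerClass A.dim A.X ((s : ℂ) • h))
    (hφQ : ∀ x y, polarizationPairingOne A.X h (A.dim - 1) (pullbackOne A φ x) (pullbackOne A φ y) =
      (d : ℂ) • polarizationPairingOne A.X h (A.dim - 1) x y) :
    ∀ (u : complexBetti A.X 1 ≃ₗ[ℂ] complexBetti A.X 1) (hu : u ∈ unitaryCentralizerGroup A h),
      detOnEigenspace u (pullbackOne A φ) (fun x ↦ (mem_centralizerGroup_iff.1 hu.1) φ x)
        (Complex.I * (Real.sqrt d : ℂ)) = 1 → u ∈ hodgeGroupOne A.dim A.X := by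
  haveI : HodgeTensorFacts.{0, 0} := hodgeTensorFacts_holds
  obtain ⟨ψ⟩ := BettiUniverse.hodge_isPolarizable exists_isReal_hodgeModel_holds
    (AbelianVariety.isSmoothProjective_holds (A := A)) 1
  have hX : IsSmoothProjective A.dim A.X := AbelianVariety.isSmoothProjective_holds
  -- `|ι| = 3`, `dim A = |ι| · 2`
  have hcard3 : Fintype.card ι = 3 := by
    apply le_antisymm hι
    have hc := Finset.card_le_univ ({k₁, k₂, k₀} : Finset ι)
    rwa [Finset.card_insert_of_notMem (by simp [hk₁₂, hk₁]), Finset.card_insert_of_notMem (by simp [hk₂]),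
      Finset.card_singleton] at hc
  have hdim : A.dim = Fintype.card ι * 2 := by rw [hW.dim_eq, hcard3]
  -- `h` is a rational `(1,1)`-class; `Q_h` is non-degenerate on `H¹` (hard Lefschetz)
  obtain ⟨s, hs, hsK⟩ := hK
  have h11 : IsOfHodgeType A.dim A.X (2 * 1) 1 1 h := isOfHodgeType_one_one_of_isKaehlerClass_smul ⟨s, hs.ne', hsK⟩
  have hh : h ∈ hodgeClassSpan A.dim A.X 1 := Submodule.subset_span ⟨hQ, h11⟩
  have hHL : HasHardLefschetzProperty h A.dim := by
    have h1 := HasHardLefschetzProperty.smul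
      (hsK.hasHardLefschetzProperty hX fun _ ↦ Motives.hasHardLefschetzProperty_kaehlerClass_holds)
      (inv_ne_zero (Complex.ofReal_ne_zero.2 hs.ne'))
    rwa [smul_smul, inv_mul_cancel₀ (Complex.ofReal_ne_zero.2 hs.ne'), one_smul] at h1
  have hnd : ∀ x : complexBetti A.X 1, (∀ y, polarizationPairingOne A.X h (A.dim - 1) x y = 0) → x = 0 :=
    fun x hx => eq_zero_of_forall_polarizationPairingOne_eq_zero_of_hasHardLefschetzProperty
      (by rw [hW.dim_eq]; norm_num) hHL hx
  exact fun u hu hdet ↦ hW.mem_hodgeGroupOne_of_mem_unitaryCentralizerGroup_of_cmField_of_hodgeLieC φE hE μ hinj hdist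
    two_pos hmult hdim hKE hKE' ψ (hW.mem_hodgeLieC_of_commute_of_skew_of_trace_of_cmField hι hS φE hE μ hinj hdist hmult
      k₀ hk₀ hunb k₁ k₂ hk₁₂ hk₁ hk₂ hKW hKE hKE' ψ) hh hnd hφQ u hu hdet

end Socket

/-! ## §1–§3 Row 13, every member: the census, the isogeny class, HC ⟸ {Markman₆, R-W6} -/

section Census

variable (A : AbelianVariety ℂ) (φ : A ⟶ A) (d : ℕ) {h : complexBetti A.X 2}

/-- **TABLE X ROW 13 `g6.IV(3,1).kE0` — EVERY MEMBER, KERNEL VERDICT, NO Hodge-group and NO Lie hypothesis displayed.**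
L16b's `WeilERows.census_weilType_generalE_of_adjoin_rosati` with its displayed general-member hypothesis `hG` («Hg(A) ⊇
S(A)(ℂ) ∩ SU_K») REPLACED by the row-13 member data: `dim_ℚ End⁰(A) = 2|ι|` (`|ι| ≤ 3`), a CM type `μ` of `φ_E^*` of pair
multiplicity `2` with ONE balanced place `k₀` and unbalanced places `k₁ ≠ k₂` of `K`-signature `n_{μ k₁} + n_{μ k₂} = 2`, and
`μ` the `K`-fibre (`W_{μ k} ⊆ W_K`, `W_{μ̄ k} ⊆ W̄_K`); `hG` is DISCHARGED by `hG_of_kWeil_cmField` (§0). Conclusion: `(dim A = 6 ∧ ¬ 𝒞 A)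
∧` X2-at-`A` `∧` X1-at-`A` (`B² ⊆ D²`, `B³ ⊆ D³ + W_K`). HC NOT proved (X2 ∕ X1 are census conjuncts).
[cite: MoonenZarhin1998WeilClasses, §4 Remark (1)] [cite: MoonenZarhin1999LowDim, (1.9) and (2.3)]
[cite: Milne1999LefschetzClasses, Thm. 3.2 and Cor. 4.5] [cite: vanGeemen1994HodgeAV, Thm. 6.12 and 4.9] -/
theorem census_row13_kWeil (hW : IsWeilType A φ 3 d) (hS : IsSimple A) (hcm : ¬ IsOfCMType A)
    (φE φEdag : A ⟶ A) (hgen : ∀ ψ : A ⟶ A, pullbackOne A ψ ∈ Algebra.adjoin ℂ {pullbackOne A φE})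
    (hdiag : ⨆ μ : ℂ, Module.End.eigenspace (pullbackOne A φE) μ = ⊤)
    (hQ : IsRationalClass h) (hK : ∃ s : ℝ, 0 < s ∧ IsKaehlerClass A.dim A.X ((s : ℂ) • h))
    (hRos : ∀ x y : complexBetti A.X 1,
      polarizationPairingOne A.X h (A.dim - 1) (pullbackOne A φE x) y =
        polarizationPairingOne A.X h (A.dim - 1) x (pullbackOne A φEdag y))
    (hφQ : ∀ x y, polarizationPairingOne A.X h (A.dim - 1) (pullbackOne A φ x) (pullbackOne A φ y) =
      (d : ℂ) • polarizationPairingOne A.X h (A.dim - 1) x y)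
    {ι : Type} [Fintype ι] [DecidableEq ι] (hι : Fintype.card ι ≤ 3)
    (hE : Module.finrank ℚ A.endAlgebra = 2 * Fintype.card ι)
    (μ : ι → ℂ) (hinj : Function.Injective μ) (hdist : ∀ k k', μ k' ≠ starRingEnd ℂ (μ k))
    (hmult : ∀ k, eigenMultiplicity A φE (μ k) + eigenMultiplicity A φE (starRingEnd ℂ (μ k)) = 2)
    (k₀ : ι) (hk₀ : eigenMultiplicity A φE (μ k₀) ≠ 0 ∧ eigenMultiplicity A φE (starRingEnd ℂ (μ k₀)) ≠ 0)
    (hunb : ∀ k, k ≠ k₀ → eigenMultiplicity A φE (μ k) = 0 ∨ eigenMultiplicity A φE (starRingEnd ℂ (μ k)) = 0)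
    (k₁ k₂ : ι) (hk₁₂ : k₁ ≠ k₂) (hk₁ : k₁ ≠ k₀) (hk₂ : k₂ ≠ k₀)
    (hKW : eigenMultiplicity A φE (μ k₁) + eigenMultiplicity A φE (μ k₂) = 2)
    (hKE : ∀ k, Module.End.eigenspace (((bettiCohomology.map φE.hom.hom.hom 1).hom).baseChange ℂ) (μ k) ≤
      Module.End.eigenspace (((bettiCohomology.map φ.hom.hom.hom 1).hom).baseChange ℂ) (Complex.I * (Real.sqrt d : ℂ)))
    (hKE' : ∀ k, Module.End.eigenspace (((bettiCohomology.map φE.hom.hom.hom 1).hom).baseChange ℂ) (starRingEnd ℂ (μ k)) ≤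
      Module.End.eigenspace (((bettiCohomology.map φ.hom.hom.hom 1).hom).baseChange ℂ) (-(Complex.I * (Real.sqrt d : ℂ)))) :
    (A.dim = 6 ∧ ¬ (IsOfCMType A ∨ ProdCMCell IsQuarticFieldTypeIVFourfold (fun Z ↦ Z.dim = 2) A)) ∧
    (∀ c : complexBetti A.X (2 * 2), IsRationalClass c → IsOfHodgeType A.dim A.X (2 * 2) 2 2 c →
      c ∈ divisorClassesSpan A.X A.dim 2 ⊔ Submodule.span ℂ {w' : complexBetti A.X (2 * 2) |
        ∃ (C : AbelianVariety ℂ) (g : A.X ⟶ C.X) (w : complexBetti C.X (2 * 2)), C.dim < A.dim ∧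
          IsRationalClass w ∧ IsOfHodgeType C.dim C.X (2 * 2) 2 2 w ∧ w' = complexBetti.map g (2 * 2) w}) ∧
    (∀ c : complexBetti A.X (2 * 3), IsRationalClass c → IsOfHodgeType A.dim A.X (2 * 3) 3 3 c →
      c ∈ divisorClassesSpan A.X A.dim 3 ⊔ Submodule.span ℂ {w' : complexBetti A.X (2 * 3) |
          ∃ (a : complexBetti A.X (2 * 2)) (b : complexBetti A.X (2 * 1)),
            IsRationalClass a ∧ IsOfHodgeType A.dim A.X (2 * 2) 2 2 a ∧ IsRationalClass b ∧
            IsOfHodgeType A.dim A.X (2 * 1) 1 1 b ∧ w' = cupProduct (two_mul_add_two_mul 2 1) a b} ⊔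
        Submodule.span ℂ {w' : complexBetti A.X (2 * 3) |
          ∃ (C : AbelianVariety ℂ) (g : A.X ⟶ C.X) (w : complexBetti C.X (2 * 3)), C.dim < A.dim ∧
            IsRationalClass w ∧ IsOfHodgeType C.dim C.X (2 * 3) 3 3 w ∧ w' = complexBetti.map g (2 * 3) w} ⊔
        Submodule.span ℂ {w' : complexBetti A.X (2 * 3) |
          ∃ (B' : AbelianVariety ℂ) (g : A.X ⟶ B'.X) (d : ℕ) (ψ : B' ⟶ B') (w : complexBetti B'.X (2 * 3)),
            B'.dim = 6 ∧ 0 < d ∧ ψ ≫ ψ = -(d • 𝟙 B') ∧ IsRationalClass w ∧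
            IsOfHodgeType B'.dim B'.X (2 * 3) 3 3 w ∧ w ∈ weilClassesOf B' ψ 3 d ∧
            w' = complexBetti.map g (2 * 3) w}) := by
  haveI : HodgeTensorFacts.{0, 0} := hodgeTensorFacts_holds
  exact WeilERows.census_weilType_generalE_of_adjoin_rosati A φ d hW hS hcm φE φEdag hgen hdiag hQ hK hRos hφQ
    (hG_of_kWeil_cmField hι hW hS φE hE μ hinj hdist hmult k₀ hk₀ hunb k₁ k₂ hk₁₂ hk₁ hk₂ hKW hKE hKE' hQ hK
      hφQ)

/-- **Row 13, every member, on the whole ISOGENY CLASS** (L16b `…_of_isIsogenous` with `hG` discharged).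
[cite: Milne1999LefschetzClasses, Thm. 3.2 and Cor. 4.5] [cite: vanGeemen1994HodgeAV, Lemma 3.7 and Thm. 6.12] -/
theorem census_row13_kWeil_of_isIsogenous {A' : AbelianVariety ℂ} (hW : IsWeilType A φ 3 d)
    (hS : IsSimple A) (hcm : ¬ IsOfCMType A)
    (φE φEdag : A ⟶ A) (hgen : ∀ ψ : A ⟶ A, pullbackOne A ψ ∈ Algebra.adjoin ℂ {pullbackOne A φE})
    (hdiag : ⨆ μ : ℂ, Module.End.eigenspace (pullbackOne A φE) μ = ⊤)
    (hQ : IsRationalClass h) (hK : ∃ s : ℝ, 0 < s ∧ IsKaehlerClass A.dim A.X ((s : ℂ) • h))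
    (hRos : ∀ x y : complexBetti A.X 1,
      polarizationPairingOne A.X h (A.dim - 1) (pullbackOne A φE x) y =
        polarizationPairingOne A.X h (A.dim - 1) x (pullbackOne A φEdag y))
    (hφQ : ∀ x y, polarizationPairingOne A.X h (A.dim - 1) (pullbackOne A φ x) (pullbackOne A φ y) =
      (d : ℂ) • polarizationPairingOne A.X h (A.dim - 1) x y)
    {ι : Type} [Fintype ι] [DecidableEq ι] (hι : Fintype.card ι ≤ 3)
    (hE : Module.finrank ℚ A.endAlgebra = 2 * Fintype.card ι)
    (μ : ι → ℂ) (hinj : Function.Injective μ) (hdist : ∀ k k', μ k' ≠ starRingEnd ℂ (μ k))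
    (hmult : ∀ k, eigenMultiplicity A φE (μ k) + eigenMultiplicity A φE (starRingEnd ℂ (μ k)) = 2)
    (k₀ : ι) (hk₀ : eigenMultiplicity A φE (μ k₀) ≠ 0 ∧ eigenMultiplicity A φE (starRingEnd ℂ (μ k₀)) ≠ 0)
    (hunb : ∀ k, k ≠ k₀ → eigenMultiplicity A φE (μ k) = 0 ∨ eigenMultiplicity A φE (starRingEnd ℂ (μ k)) = 0)
    (k₁ k₂ : ι) (hk₁₂ : k₁ ≠ k₂) (hk₁ : k₁ ≠ k₀) (hk₂ : k₂ ≠ k₀)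
    (hKW : eigenMultiplicity A φE (μ k₁) + eigenMultiplicity A φE (μ k₂) = 2)
    (hKE : ∀ k, Module.End.eigenspace (((bettiCohomology.map φE.hom.hom.hom 1).hom).baseChange ℂ) (μ k) ≤
      Module.End.eigenspace (((bettiCohomology.map φ.hom.hom.hom 1).hom).baseChange ℂ) (Complex.I * (Real.sqrt d : ℂ)))
    (hKE' : ∀ k, Module.End.eigenspace (((bettiCohomology.map φE.hom.hom.hom 1).hom).baseChange ℂ) (starRingEnd ℂ (μ k)) ≤
      Module.End.eigenspace (((bettiCohomology.map φ.hom.hom.hom 1).hom).baseChange ℂ) (-(Complex.I * (Real.sqrt d : ℂ))))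
    (hA'A : IsIsogenous A' A) :
    (A'.dim = 6 ∧ ¬ (IsOfCMType A' ∨ ProdCMCell IsQuarticFieldTypeIVFourfold (fun Z ↦ Z.dim = 2) A')) ∧
    (∀ c : complexBetti A'.X (2 * 2), IsRationalClass c → IsOfHodgeType A'.dim A'.X (2 * 2) 2 2 c →
      c ∈ divisorClassesSpan A'.X A'.dim 2 ⊔ Submodule.span ℂ {w' : complexBetti A'.X (2 * 2) |
        ∃ (C : AbelianVariety ℂ) (g : A'.X ⟶ C.X) (w : complexBetti C.X (2 * 2)), C.dim < A'.dim ∧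
          IsRationalClass w ∧ IsOfHodgeType C.dim C.X (2 * 2) 2 2 w ∧ w' = complexBetti.map g (2 * 2) w}) ∧
    (∀ c : complexBetti A'.X (2 * 3), IsRationalClass c → IsOfHodgeType A'.dim A'.X (2 * 3) 3 3 c →
      c ∈ divisorClassesSpan A'.X A'.dim 3 ⊔ Submodule.span ℂ {w' : complexBetti A'.X (2 * 3) |
          ∃ (a : complexBetti A'.X (2 * 2)) (b : complexBetti A'.X (2 * 1)),
            IsRationalClass a ∧ IsOfHodgeType A'.dim A'.X (2 * 2) 2 2 a ∧ IsRationalClass b ∧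
            IsOfHodgeType A'.dim A'.X (2 * 1) 1 1 b ∧ w' = cupProduct (two_mul_add_two_mul 2 1) a b} ⊔
        Submodule.span ℂ {w' : complexBetti A'.X (2 * 3) |
          ∃ (C : AbelianVariety ℂ) (g : A'.X ⟶ C.X) (w : complexBetti C.X (2 * 3)), C.dim < A'.dim ∧
            IsRationalClass w ∧ IsOfHodgeType C.dim C.X (2 * 3) 3 3 w ∧ w' = complexBetti.map g (2 * 3) w} ⊔
        Submodule.span ℂ {w' : complexBetti A'.X (2 * 3) |
          ∃ (B' : AbelianVariety ℂ) (g : A'.X ⟶ B'.X) (d : ℕ) (ψ : B' ⟶ B') (w : complexBetti B'.X (2 * 3)),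
            B'.dim = 6 ∧ 0 < d ∧ ψ ≫ ψ = -(d • 𝟙 B') ∧ IsRationalClass w ∧
            IsOfHodgeType B'.dim B'.X (2 * 3) 3 3 w ∧ w ∈ weilClassesOf B' ψ 3 d ∧
            w' = complexBetti.map g (2 * 3) w}) := by
  haveI : HodgeTensorFacts.{0, 0} := hodgeTensorFacts_holds
  exact WeilERows.census_weilType_generalE_of_adjoin_rosati_of_isIsogenous A φ d hW hS hcm φE φEdag hgen hdiag hQ hK hRos hφQ
    (hG_of_kWeil_cmField hι hW hS φE hE μ hinj hdist hmult k₀ hk₀ hunb k₁ k₂ hk₁₂ hk₁ hk₂ hKW hKE hKE' hQ hK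
      hφQ) hA'A

/-- **HC for every row-13 member ⟸ {Markman₆ (preprint, UNREFEREED), R-W6 (OPEN)}, both DISPLAYED** (L16b's
`hodgeConjectureFor_weilType_generalE_of_adjoin_rosati_of_markman₆_nonsplit` with `hG` discharged; `A` simple is now a
binder). HC NOT proved unconditionally. [cite: Markman2025SecantWeil, Thm. 1.5.1 (preprint, unrefereed)]
[claim: Markman2025SurveySecant, status: under-review] [cite: vanGeemen1994HodgeAV, Thm. 6.12] -/
theorem hodgeConjectureFor_row13_kWeil_of_markman₆_nonsplit
    (hMark₆ : Markman2025_weilClasses_algebraic_hyperbolicSixfold) (hRW6 : WeilTypeLadder.NonsplitSixfolds)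
    (hW : IsWeilType A φ 3 d) (hS : IsSimple A) (φE φEdag : A ⟶ A)
    (hgen : ∀ ψ : A ⟶ A, pullbackOne A ψ ∈ Algebra.adjoin ℂ {pullbackOne A φE})
    (hdiag : ⨆ μ : ℂ, Module.End.eigenspace (pullbackOne A φE) μ = ⊤)
    (hQ : IsRationalClass h) (hK : ∃ s : ℝ, 0 < s ∧ IsKaehlerClass A.dim A.X ((s : ℂ) • h))
    (hRos : ∀ x y : complexBetti A.X 1,
      polarizationPairingOne A.X h (A.dim - 1) (pullbackOne A φE x) y =
        polarizationPairingOne A.X h (A.dim - 1) x (pullbackOne A φEdag y))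
    (hφQ : ∀ x y, polarizationPairingOne A.X h (A.dim - 1) (pullbackOne A φ x) (pullbackOne A φ y) =
      (d : ℂ) • polarizationPairingOne A.X h (A.dim - 1) x y)
    {ι : Type} [Fintype ι] [DecidableEq ι] (hι : Fintype.card ι ≤ 3)
    (hE : Module.finrank ℚ A.endAlgebra = 2 * Fintype.card ι)
    (μ : ι → ℂ) (hinj : Function.Injective μ) (hdist : ∀ k k', μ k' ≠ starRingEnd ℂ (μ k))
    (hmult : ∀ k, eigenMultiplicity A φE (μ k) + eigenMultiplicity A φE (starRingEnd ℂ (μ k)) = 2)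
    (k₀ : ι) (hk₀ : eigenMultiplicity A φE (μ k₀) ≠ 0 ∧ eigenMultiplicity A φE (starRingEnd ℂ (μ k₀)) ≠ 0)
    (hunb : ∀ k, k ≠ k₀ → eigenMultiplicity A φE (μ k) = 0 ∨ eigenMultiplicity A φE (starRingEnd ℂ (μ k)) = 0)
    (k₁ k₂ : ι) (hk₁₂ : k₁ ≠ k₂) (hk₁ : k₁ ≠ k₀) (hk₂ : k₂ ≠ k₀)
    (hKW : eigenMultiplicity A φE (μ k₁) + eigenMultiplicity A φE (μ k₂) = 2)
    (hKE : ∀ k, Module.End.eigenspace (((bettiCohomology.map φE.hom.hom.hom 1).hom).baseChange ℂ) (μ k) ≤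
      Module.End.eigenspace (((bettiCohomology.map φ.hom.hom.hom 1).hom).baseChange ℂ) (Complex.I * (Real.sqrt d : ℂ)))
    (hKE' : ∀ k, Module.End.eigenspace (((bettiCohomology.map φE.hom.hom.hom 1).hom).baseChange ℂ) (starRingEnd ℂ (μ k)) ≤
      Module.End.eigenspace (((bettiCohomology.map φ.hom.hom.hom 1).hom).baseChange ℂ) (-(Complex.I * (Real.sqrt d : ℂ)))) :
    HodgeConjectureFor A.dim A.X := by
  haveI : HodgeTensorFacts.{0, 0} := hodgeTensorFacts_holds
  exact WeilERows.hodgeConjectureFor_weilType_generalE_of_adjoin_rosati_of_markman₆_nonsplit A φ d hMark₆ hRW6 hW φE φEdag hgen hdiag hQ hK hRos hφQ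
    (hG_of_kWeil_cmField hι hW hS φE hE μ hinj hdist hmult k₀ hk₀ hunb k₁ k₂ hk₁₂ hk₁ hk₂ hKW hKE hKE' hQ hK
      hφQ)

end Census

end Summit.HodgeConjecture.HodgeConjecture.TableX.WeilLieRows
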